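import Mathlib

/-!
# (A1′) of the N5 [A]-ledger, linear-algebra half: characters of `E` trivial on `F` ↔ characters of `F`

Kernel witnesses (Mathlib only) for the first half of item (A1′) of route/T5-route-2.md §N5.12.6
(«the characters of `E_v` trivial on `F_v` are `x ↦ ψ₀(t x)`, `t ∈ F_v` (`E_v / F_v ≅ F_v` as a
one-dimensional `F_v`-space; Pontryagin dual of `F_v = {ψ(t·)}`); non-trivial ones: `t ≠ 0`»):

* with a basis `b = (1, δ)` of `E` over `F` (built from `E = F ⊕ F·δ`, i.e. from the spanning and
  uniqueness statements of `T5QuadraticInvolution.exists_eq_add_mul` /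
  `eq_zero_of_add_mul_eq_zero`, by `basisOfSpanUniq`), the `δ`-coordinate `E → F` is additive and
  kills `F` (`coordHom`, `coordHom_algebraMap`, `coordHom_smul`);
* every character `φ` of `(F, +)` gives the character `y ↦ φ(coord y)` of `(E, +)`, trivial on `F`
  (`ofBase`, `ofBase_algebraMap`), and every character `ψ` of `(E, +)` trivial on `F` arises this
  way from `c ↦ ψ(c δ)` (`toBase`, `ofBase_toBase`); the two constructions are inverse bijections
  (`trivialOnBaseEquiv`), and non-trivial characters correspond to non-trivial ones
  (`ofBase_eq_one_iff`).

So «characters of `E_v` trivial on `F_v`» = «characters of `F_v`», transported along `δ`. What stays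
prose is the Pontryagin half: the characters of `(F_v, +)` are the `ψ(t ·)`, `t ∈ F_v` (with
`ψ₀ := ofBase ψ`, the character `y ↦ ψ(t · coord y)` is `ofBase (ψ(t ·))`).

Uses an L-value-free non-vanishing device: NO (README §8(d)).
-/

namespace Summit.Ventures.HodgeRepro2.T5CharactersTrivialOnBase

section Basis

variable {F E : Type*} [Field F] [Field E] [Algebra F E]

/-- The basis `(1, δ)` of `E` over `F` from `E = F ⊕ F·δ` (spanning + uniqueness of the
coefficients, the conclusions of `T5QuadraticInvolution.exists_eq_add_mul` and
`eq_zero_of_add_mul_eq_zero`). -/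
noncomputable def basisOfSpanUniq (δ : E)
    (hspan : ∀ y : E, ∃ a c : F, y = algebraMap F E a + algebraMap F E c * δ)
    (huniq : ∀ a c : F, algebraMap F E a + algebraMap F E c * δ = 0 → a = 0 ∧ c = 0) :
    Module.Basis (Fin 2) F E :=
  Module.Basis.mk (v := ![1, δ])
    (LinearIndependent.pair_iff.2 fun s t h => by
      apply huniq s t
      simpa [Algebra.smul_def] using h)
    (fun y _ => by
      obtain ⟨a, c, hy⟩ := hspan y
      rw [Submodule.mem_span_range_iff_exists_fun]
      refine ⟨![a, c], ?_⟩
      rw [Fin.sum_univ_two]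
      simp [hy, Algebra.smul_def])

/-- The first basis vector is `1`. -/
@[simp]
theorem basisOfSpanUniq_zero (δ : E) (hspan) (huniq) :
    basisOfSpanUniq (F := F) δ hspan huniq 0 = 1 := by
  simp [basisOfSpanUniq]

/-- The second basis vector is `δ`. -/
@[simp]
theorem basisOfSpanUniq_one (δ : E) (hspan) (huniq) :
    basisOfSpanUniq (F := F) δ hspan huniq 1 = δ := by
  simp [basisOfSpanUniq]

end Basis

section Coordinate

variable {F E : Type*} [Field F] [Field E] [Algebra F E] (b : Module.Basis (Fin 2) F E)

/-- The `δ`-coordinate `E → F` with respect to a basis `b = (1, δ)`, as an additive homomorphism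
(«`E_v / F_v ≅ F_v`»). -/
noncomputable def coordHom : E →+ F := (b.coord 1).toAddMonoidHom

/-- `coordHom b y` is the second coordinate of `y`. -/
theorem coordHom_apply (y : E) : coordHom b y = b.repr y 1 := rfl

/-- The decomposition `y = a + c δ` with `a = b.repr y 0`, `c = b.repr y 1` (for `b 0 = 1`). -/
theorem eq_algebraMap_add_smul (hb0 : b 0 = 1) (y : E) :
    y = algebraMap F E (b.repr y 0) + b.repr y 1 • b 1 := by
  conv_lhs => rw [← b.sum_repr y]
  rw [Fin.sum_univ_two, hb0, Algebra.algebraMap_eq_smul_one]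

/-- The `δ`-coordinate kills `F` (for `b 0 = 1`). -/
theorem coordHom_algebraMap (hb0 : b 0 = 1) (a : F) : coordHom b (algebraMap F E a) = 0 := by
  rw [coordHom_apply, Algebra.algebraMap_eq_smul_one, ← hb0, map_smul, b.repr_self]
  simp

/-- The `δ`-coordinate of `c δ` is `c`. -/
theorem coordHom_smul (c : F) : coordHom b (c • b 1) = c := by
  rw [coordHom_apply, map_smul, b.repr_self]
  simp

/-- The `δ`-coordinate is surjective. -/
theorem coordHom_surjective : Function.Surjective (coordHom b) :=
  fun c => ⟨c • b 1, coordHom_smul b c⟩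

end Coordinate

section Characters

variable {F E M : Type*} [Field F] [Field E] [Algebra F E] [CommMonoid M]
variable (b : Module.Basis (Fin 2) F E)

/-- The character `y ↦ φ(coord y)` of `(E, +)` attached to a character `φ` of `(F, +)`
(«`x ↦ ψ(t x)` read through `E_v / F_v ≅ F_v`»). -/
noncomputable def ofBase (φ : AddChar F M) : AddChar E M := φ.compAddMonoidHom (coordHom b)

/-- `ofBase b φ y = φ (coordHom b y)`. -/
theorem ofBase_apply (φ : AddChar F M) (y : E) : ofBase b φ y = φ (coordHom b y) := rfl

/-- `ofBase b φ` is trivial on `F` (for `b 0 = 1`). -/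
theorem ofBase_algebraMap (hb0 : b 0 = 1) (φ : AddChar F M) (a : F) :
    ofBase b φ (algebraMap F E a) = 1 := by
  rw [ofBase_apply, coordHom_algebraMap b hb0, AddChar.map_zero_eq_one]

/-- `ofBase b φ (c δ) = φ c`. -/
theorem ofBase_smul (φ : AddChar F M) (c : F) : ofBase b φ (c • b 1) = φ c := by
  rw [ofBase_apply, coordHom_smul]

/-- The character `c ↦ ψ(c δ)` of `(F, +)` attached to a character `ψ` of `(E, +)`. -/
noncomputable def toBase (ψ : AddChar E M) : AddChar F M :=
  ψ.compAddMonoidHom (LinearMap.toSpanSingleton F E (b 1)).toAddMonoidHom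

/-- `toBase b ψ c = ψ (c • δ)`. -/
theorem toBase_apply (ψ : AddChar E M) (c : F) : toBase b ψ c = ψ (c • b 1) := rfl

/-- Every character of `(E, +)` trivial on `F` is `ofBase` of its restriction to the line `F δ`
(for `b 0 = 1`): the characters of `E` trivial on `F` are exactly the `ofBase b φ`. -/
theorem ofBase_toBase (hb0 : b 0 = 1) (ψ : AddChar E M) (hψ : ∀ a : F, ψ (algebraMap F E a) = 1) :
    ofBase b (toBase b ψ) = ψ := by
  ext y
  rw [ofBase_apply, toBase_apply, coordHom_apply]
  conv_rhs => rw [eq_algebraMap_add_smul b hb0 y]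
  rw [AddChar.map_add_eq_mul, hψ, one_mul]

/-- `toBase` is a left inverse of `ofBase`. -/
theorem toBase_ofBase (φ : AddChar F M) : toBase b (ofBase b φ) = φ := by
  ext c
  rw [toBase_apply, ofBase_smul]

/-- The bijection «characters of `(E, +)` trivial on `F`» ≃ «characters of `(F, +)`» (for `b 0 = 1`):
the linear-algebra half of (A1′). -/
noncomputable def trivialOnBaseEquiv (hb0 : b 0 = 1) :
    {ψ : AddChar E M // ∀ a : F, ψ (algebraMap F E a) = 1} ≃ AddChar F M where
  toFun ψ := toBase b ψ.1
  invFun φ := ⟨ofBase b φ, ofBase_algebraMap b hb0 φ⟩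
  left_inv ψ := Subtype.ext (ofBase_toBase b hb0 ψ.1 ψ.2)
  right_inv φ := toBase_ofBase b φ

/-- `ofBase b φ` is trivial iff `φ` is («non-trivial ones: `t ≠ 0`»). -/
theorem ofBase_eq_one_iff (φ : AddChar F M) : ofBase b φ = 1 ↔ φ = 1 := by
  constructor
  · intro h
    ext c
    rw [← ofBase_smul b φ c, h, AddChar.one_apply, AddChar.one_apply]
  · rintro rfl
    ext y
    rw [ofBase_apply, AddChar.one_apply, AddChar.one_apply]

/-- A character of `(E, +)` trivial on `F` is trivial iff its restriction to the line `F δ` is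
(for `b 0 = 1`). -/
theorem eq_one_iff_toBase_eq_one (hb0 : b 0 = 1) (ψ : AddChar E M)
    (hψ : ∀ a : F, ψ (algebraMap F E a) = 1) : ψ = 1 ↔ toBase b ψ = 1 := by
  rw [← ofBase_toBase b hb0 ψ hψ, ofBase_eq_one_iff, toBase_ofBase]

end Characters

end Summit.Ventures.HodgeRepro2.T5CharactersTrivialOnBase
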